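import Summits.CriticalPhenomena.Ising3DConformalLimit.Theses.FKParityRobustness
import Summits.CriticalPhenomena.Ising3DConformalLimit.Theorems.FKParityRobustnessIndependentStrandsJoinShapeSandwich
import Summits.CriticalPhenomena.Ising3DConformalLimit.Theorems.FKParityRobustnessIndependentStrandsJoinShapeResidual
import Summits.CriticalPhenomena.Ising3DConformalLimit.Theorems.FKParityRobustnessLatticeBoundFromStrands
import Summits.CriticalPhenomena.Ising3DConformalLimit.Theorems.FKParityRobustnessIndependentStrandsJoinLimitUpgrade
import HarnessLib

/-!
# The loop-language ∃-shape dictionary: clause (iii) ⟺ pairing-summed independent strands join along SOME lattice shape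

Helper file of the crux `IndependentStrandsJoin` (item stmt-CriticalPhenomena-14625, route `FKParityRobustness`; line
`pinch-to-tetra` r5, lead c5-0).  In the route's own vocabulary (free box `Λ_N ⊂ ℤ³`, `G_N` the induced graph, `t_c = tanh β_c(3)`,
loop-O(1) partition functions `Z_N`, and the crux's joint sum `jointSum_N(xy|zw)` of two INDEPENDENT sourced loop-O(1)
configurations joining `x` to `z`), write **LSM** ("loop shape merging") for

  `∃ a : Fin 4 → ℤ³ injective, ∃ c > 0, ∀ L₀, ∃ L ≥ L₀, ∃ N₀, ∀ N ≥ N₀,` at `b = L•a ⊂ Λ_N`: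
  `c · Z_N(b₀b₁) · Z_N(b₂b₃) ≤ jointSum_N(b₀b₁|b₂b₃) + jointSum_N(b₀b₂|b₁b₃) + jointSum_N(b₀b₃|b₁b₂)`

(spelled out verbatim below; no definition is introduced): along infinitely many dilations of SOME lattice shape, two independent
critical HT strands join for at least one of the three pairings, with probability bounded below (up to two-point ratios).

* `criticalDefect_le_of_boxDefect` / `boxDefect_lt_of_criticalDefect` — the passages free boxes ⟷ critical state for the
  Ursell defect `U₄ + c·⟨σσ⟩⟨σσ⟩` at a general injective lattice quadruple (the landed transports `connectedFour_boxComap`,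
  `twoPoint_boxComap` and the box limits `criticalCorr_wellDefined_holds`; general-shape forms of the landed
  `criticalDefect_le_of_join` / `boxU4Bound_of_critical`).
* `shapeMergingIO_of_loopShapeMerging` — **LSM ⟹ far merging i.o.** along the same shape (the general lower sandwich
  `3·U₄·(Z⁰)² ≤ −2·Σ_π jointSum_π` of `…ShapeSandwich.lean`, i.e. `StrandsJoinBound` at the three relabellings); hence
  `nonGaussianLimit_of_loopShapeMerging : LSM → NonGaussianLimit` (closed glue `FarMergingGivesU4`, item 4471) — no limit needed.
* (companion file `…ShapeLoopResidual.lean`) `loopShapeMergingEventually_of_shapeMergingEventually` — **SME ⟹ LSM** (even at ALL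
  large dilations); `nonGaussianLimit_iff_loopShapeMerging` — **under `LimitExists`: `NonGaussianLimit` (item 0636) ↔ LSM**;
  `loopShapeMerging_of_independentStrandsJoin` — the crux implies LSM outright; registered sub-goal `stub_shapeLoopDictionary`.
So a planner who restates the crux as LSM keeps the route's thesis (independent critical HT strands join) and obtains a leaf that is
kernel-EQUIVALENT to item 0636 modulo `LimitExists`; the fixed tetrahedron and the fixed pairing of the present text are exactly what
the residual `ShapeTransfer` of r5 pays for.

References: M. Aizenman, Comm. Math. Phys. 86 (1982), Prop. 5.3 [AizenmanCMP1982]; M. Aizenman, H. Duminil-Copin, V. Sidoravicius,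
Comm. Math. Phys. 334 (2015), Thm. 1.2 (continuity at `β_c(ℤ³)`, behind `criticalCorr_wellDefined_holds`) [AizenmanDuminilCopinSidoraviciusCMP2015].
-/

noncomputable section

open Filter Topology Finset SimpleGraph
open Literature.Probability.LatticeModels
open Summit.CriticalPhenomena.Ising3DConformalLimit.Theses.FKParityRobustness
open Summit.CriticalPhenomena.Ising3DConformalLimit.FKParityRobustnessLatticeBoundFromStrands
  (connectedFour_boxComap twoPoint_boxComap nPoint_boxComap twoPoint_eq_loopO1_div twoPoint_eq_isingExpect_spinMonomial
   tetraDefect_le_of_tendsto')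
open Summit.CriticalPhenomena.Ising3DConformalLimit.FKParityRobustnessFarMergingGivesU4 (farMergingGivesU4_proof)
open Summit.CriticalPhenomena.Ising3DConformalLimit.Cruxes.IsingEuclidUpgradeR4NonGaussian.FreeCovarianceDeltaDichotomy
  (criticalCorr_two_pos')
open Summit.CriticalPhenomena.Ising3DConformalLimit.Cruxes.ParityRobustMerging.PlaquetteXorSurgery (tetra tetra_inj)

namespace Summit.CriticalPhenomena.Ising3DConformalLimit.Cruxes.IndependentStrandsJoin.PinchToTetra

open scoped Classical BigOperators

/-! ## Dilated shapes in boxes -/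

/-- A dilate `L • x` of a site of the box `Λ_M` lies in `Λ_N` as soon as `L·M ≤ N`. [folklore] -/
theorem smul_mem_box_of_mul_le {x : Site 3} {M : ℕ} (hx : x ∈ box 3 M) {L N : ℕ} (h : L * M ≤ N) :
    (L : ℤ) • x ∈ box 3 N := by
  rw [mem_box] at hx ⊢
  intro k
  have hk := hx k
  have hL : (0 : ℤ) ≤ L := by positivity
  have h' : (L : ℤ) * M ≤ N := by exact_mod_cast h
  simp only [Pi.smul_apply, smul_eq_mul]
  constructor <;> nlinarith [hk.1, hk.2]

/-- Every lattice quadruple `a` has a radius `M` with `L • a ⊂ Λ_N` whenever `L·M ≤ N`. [folklore] -/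
theorem exists_radius_smul_mem_box (a : Fin 4 → Site 3) :
    ∃ M : ℕ, ∀ L N : ℕ, L * M ≤ N → ∀ i, (L : ℤ) • a i ∈ box 3 N := by
  obtain ⟨M, hM⟩ := exists_forall_subset_box (d := 3) (Finset.univ.image a)
  refine ⟨M, fun L N h i => smul_mem_box_of_mul_le ?_ h⟩
  exact hM M le_rfl (Finset.mem_image_of_mem a (Finset.mem_univ i))

/-! ## Free boxes ⟷ critical state for the Ursell defect at a general quadruple -/

/-- **Boxes ⟹ critical state.**  If for all large `N` the free box Ursell defect at the lattice quadruple `y ⊂ Λ_N` (read on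
the induced graph `G_N` of the box) satisfies `U₄ ≤ −c·⟨σσ⟩⟨σσ⟩`, then so does the critical state:
`U₄^crit(y) ≤ −c·⟨σ_{y₀}σ_{y₁}⟩⟨σ_{y₂}σ_{y₃}⟩`.  (Transports `connectedFour_boxComap` / `twoPoint_boxComap`, the seven box limits
`criticalCorr_wellDefined_holds`, closed cone `tetraDefect_le_of_tendsto'`.) [folklore] -/
theorem criticalDefect_le_of_boxDefect {c : ℝ} {y : Fin 4 → Site 3} {N₀ : ℕ}
    (hbox : ∀ N : ℕ, N₀ ≤ N → ∀ i, y i ∈ box 3 N)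
    (h : ∀ N : ℕ, N₀ ≤ N → ∀ b : Fin 4 → ↥(box 3 N), (∀ i, ((b i : Site 3)) = y i) →
      connectedFour (isingMeasure ((zdGraph 3).comap (Subtype.val : ↥(box 3 N) → Site 3)) Finset.univ
          (criticalBeta 3) 0 .free) spinAt b ≤
        -(c * (twoPoint (isingMeasure ((zdGraph 3).comap (Subtype.val : ↥(box 3 N) → Site 3)) Finset.univ
            (criticalBeta 3) 0 .free) spinAt (b 0) (b 1) *
          twoPoint (isingMeasure ((zdGraph 3).comap (Subtype.val : ↥(box 3 N) → Site 3)) Finset.univ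
            (criticalBeta 3) 0 .free) spinAt (b 2) (b 3)))) :
    criticalCorr 3 4 y - (criticalCorr 3 2 ![y 0, y 1] * criticalCorr 3 2 ![y 2, y 3] +
        criticalCorr 3 2 ![y 0, y 2] * criticalCorr 3 2 ![y 1, y 3] + criticalCorr 3 2 ![y 0, y 3] * criticalCorr 3 2 ![y 1, y 2]) ≤
      -(c * (criticalCorr 3 2 ![y 0, y 1] * criticalCorr 3 2 ![y 2, y 3])) := by
  -- the finite-volume inequality, read as `isingExpect` of spin monomials on the free box measure of `ℤ³`
  have hfin : ∀ N : ℕ, N₀ ≤ N →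
      isingExpect (zdGraph 3) (box 3 N) (criticalBeta 3) 0 .free (spinMonomial y) -
          (isingExpect (zdGraph 3) (box 3 N) (criticalBeta 3) 0 .free (spinMonomial ![y 0, y 1]) *
              isingExpect (zdGraph 3) (box 3 N) (criticalBeta 3) 0 .free (spinMonomial ![y 2, y 3]) +
            isingExpect (zdGraph 3) (box 3 N) (criticalBeta 3) 0 .free (spinMonomial ![y 0, y 2]) *
              isingExpect (zdGraph 3) (box 3 N) (criticalBeta 3) 0 .free (spinMonomial ![y 1, y 3]) +
            isingExpect (zdGraph 3) (box 3 N) (criticalBeta 3) 0 .free (spinMonomial ![y 0, y 3]) *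
              isingExpect (zdGraph 3) (box 3 N) (criticalBeta 3) 0 .free (spinMonomial ![y 1, y 2])) ≤
        -(c * (isingExpect (zdGraph 3) (box 3 N) (criticalBeta 3) 0 .free (spinMonomial ![y 0, y 1]) *
          isingExpect (zdGraph 3) (box 3 N) (criticalBeta 3) 0 .free (spinMonomial ![y 2, y 3]))) := by
    intro N hN
    let b : Fin 4 → ↥(box 3 N) := fun i => ⟨y i, hbox N hN i⟩
    have hb : ∀ i, ((b i : Site 3)) = y i := fun i => rfl
    have hU := h N hN b hb
    rw [connectedFour_boxComap (box 3 N) (criticalBeta 3) b, twoPoint_boxComap (box 3 N) (criticalBeta 3) (b 0) (b 1),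
      twoPoint_boxComap (box 3 N) (criticalBeta 3) (b 2) (b 3)] at hU
    unfold connectedFour at hU
    rw [nPoint_isingMeasure] at hU
    simp only [twoPoint_eq_isingExpect_spinMonomial] at hU
    have hU' : isingExpect (zdGraph 3) (box 3 N) (criticalBeta 3) 0 .free (spinMonomial y) -
          isingExpect (zdGraph 3) (box 3 N) (criticalBeta 3) 0 .free (spinMonomial ![y 0, y 1]) *
            isingExpect (zdGraph 3) (box 3 N) (criticalBeta 3) 0 .free (spinMonomial ![y 2, y 3]) -
          isingExpect (zdGraph 3) (box 3 N) (criticalBeta 3) 0 .free (spinMonomial ![y 0, y 2]) *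
            isingExpect (zdGraph 3) (box 3 N) (criticalBeta 3) 0 .free (spinMonomial ![y 1, y 3]) -
          isingExpect (zdGraph 3) (box 3 N) (criticalBeta 3) 0 .free (spinMonomial ![y 0, y 3]) *
            isingExpect (zdGraph 3) (box 3 N) (criticalBeta 3) 0 .free (spinMonomial ![y 1, y 2]) ≤
        -(c * (isingExpect (zdGraph 3) (box 3 N) (criticalBeta 3) 0 .free (spinMonomial ![y 0, y 1]) *
          isingExpect (zdGraph 3) (box 3 N) (criticalBeta 3) 0 .free (spinMonomial ![y 2, y 3]))) := hU
    linarith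
  have hwd := criticalCorr_wellDefined_holds (d := 3) le_rfl
  have hfree : (BoundaryCondition.free : BoundaryCondition (Site 3)) ∈
      ({.free, .plus, .minus} : Set (BoundaryCondition (Site 3))) := by simp
  exact tetraDefect_le_of_tendsto' (l := atTop) (c := c) (u₀ := criticalCorr 3 4 y)
    (g₀ := fun i j => criticalCorr 3 2 ![y i, y j])
    (g := fun (N : ℕ) (i j : Fin 4) => isingExpect (zdGraph 3) (box 3 N) (criticalBeta 3) 0 .free (spinMonomial ![y i, y j]))
    (hwd 4 y .free hfree)
    (hwd 2 ![y 0, y 1] .free hfree) (hwd 2 ![y 2, y 3] .free hfree) (hwd 2 ![y 0, y 2] .free hfree)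
    (hwd 2 ![y 1, y 3] .free hfree) (hwd 2 ![y 0, y 3] .free hfree) (hwd 2 ![y 1, y 2] .free hfree)
    (Filter.eventually_atTop.2 ⟨N₀, fun N hN => hfin N hN⟩)

/-- **Critical state ⟹ boxes (strict margin).**  If `U₄^crit(y) + c·⟨σσ⟩⟨σσ⟩^crit(y) < 0` at a lattice quadruple `y`, then for all
large `N` (beyond any requested `N₁`) the free box defect on the induced graph `G_N`, at any box copy `b` of `y`, is negative too:
`U₄ + c·⟨σσ⟩⟨σσ⟩ < 0`. [folklore] -/
theorem boxDefect_lt_of_criticalDefect {c : ℝ} {y : Fin 4 → Site 3} (N₁ : ℕ)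
    (h : criticalCorr 3 4 y - (criticalCorr 3 2 ![y 0, y 1] * criticalCorr 3 2 ![y 2, y 3] +
        criticalCorr 3 2 ![y 0, y 2] * criticalCorr 3 2 ![y 1, y 3] + criticalCorr 3 2 ![y 0, y 3] * criticalCorr 3 2 ![y 1, y 2]) +
      c * (criticalCorr 3 2 ![y 0, y 1] * criticalCorr 3 2 ![y 2, y 3]) < 0) :
    ∃ N₀ : ℕ, N₁ ≤ N₀ ∧ ∀ N : ℕ, N₀ ≤ N → ∀ b : Fin 4 → ↥(box 3 N), (∀ i, ((b i : Site 3)) = y i) →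
      connectedFour (isingMeasure ((zdGraph 3).comap (Subtype.val : ↥(box 3 N) → Site 3)) Finset.univ
          (criticalBeta 3) 0 .free) spinAt b +
        c * (twoPoint (isingMeasure ((zdGraph 3).comap (Subtype.val : ↥(box 3 N) → Site 3)) Finset.univ
            (criticalBeta 3) 0 .free) spinAt (b 0) (b 1) *
          twoPoint (isingMeasure ((zdGraph 3).comap (Subtype.val : ↥(box 3 N) → Site 3)) Finset.univ
            (criticalBeta 3) 0 .free) spinAt (b 2) (b 3)) < 0 := by
  set u : ℕ → ℝ := fun N => isingExpect (zdGraph 3) (box 3 N) (criticalBeta 3) 0 .free (spinMonomial y) with hu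
  set g : ℕ → Fin 4 → Fin 4 → ℝ := fun N i j => isingExpect (zdGraph 3) (box 3 N) (criticalBeta 3) 0 .free
    (spinMonomial ![y i, y j]) with hg
  have hwd := criticalCorr_wellDefined_holds (d := 3) le_rfl
  have hfree : (BoundaryCondition.free : BoundaryCondition (Site 3)) ∈
      ({.free, .plus, .minus} : Set (BoundaryCondition (Site 3))) := by simp
  have hu' : Tendsto u atTop (𝓝 (criticalCorr 3 4 y)) := hwd 4 y .free hfree
  have hg' : ∀ i j : Fin 4, Tendsto (fun N => g N i j) atTop (𝓝 (criticalCorr 3 2 ![y i, y j])) :=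
    fun i j => hwd 2 ![y i, y j] .free hfree
  have hD : Tendsto (fun N => u N - (g N 0 1 * g N 2 3 + g N 0 2 * g N 1 3 + g N 0 3 * g N 1 2)
      + c * (g N 0 1 * g N 2 3)) atTop (𝓝 (criticalCorr 3 4 y - (criticalCorr 3 2 ![y 0, y 1] * criticalCorr 3 2 ![y 2, y 3] +
        criticalCorr 3 2 ![y 0, y 2] * criticalCorr 3 2 ![y 1, y 3] + criticalCorr 3 2 ![y 0, y 3] * criticalCorr 3 2 ![y 1, y 2]) +
      c * (criticalCorr 3 2 ![y 0, y 1] * criticalCorr 3 2 ![y 2, y 3]))) :=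
    (hu'.sub ((((hg' 0 1).mul (hg' 2 3)).add ((hg' 0 2).mul (hg' 1 3))).add ((hg' 0 3).mul (hg' 1 2)))).add
      (((hg' 0 1).mul (hg' 2 3)).const_mul c)
  obtain ⟨N₂, hN₂⟩ := Filter.eventually_atTop.1 (hD.eventually (gt_mem_nhds h))
  refine ⟨max N₁ N₂, le_max_left _ _, fun N hN b hb => ?_⟩
  have hN₂N : N₂ ≤ N := le_of_max_le_right hN
  rw [connectedFour_boxComap (box 3 N) (criticalBeta 3) b, twoPoint_boxComap (box 3 N) (criticalBeta 3) (b 0) (b 1),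
    twoPoint_boxComap (box 3 N) (criticalBeta 3) (b 2) (b 3)]
  unfold connectedFour
  rw [nPoint_isingMeasure]
  simp only [twoPoint_eq_isingExpect_spinMonomial, hb]
  have key := hN₂ N hN₂N
  simp only [hu, hg] at key
  have e : (fun i => y i) = y := rfl
  simp only [e]
  linarith

/-! ## LSM ⟹ far merging infinitely often ⟹ clause (iii) -/

/-- **The finite-graph step of LSM ⟹ far merging**: `c·Z^{01}Z^{23} ≤ Σ_π jointSum_π` gives
`U₄ ≤ −(2c/3)·⟨σ_{a₀}σ_{a₁}⟩⟨σ_{a₂}σ_{a₃}⟩` (`connectedFour_mul_sq_le_of_jointSum3`, divide by `(Z⁰)² > 0`). [folklore] -/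
theorem defect_of_jointSum3 {V : Type} [Fintype V] [DecidableEq V] (G : SimpleGraph V) [DecidableRel G.Adj]
    {β c : ℝ} (hβ : 0 ≤ β) (a : Fin 4 → V) (ha : Function.Injective a)
    (hJ : c * loopO1PartitionFunction G (Real.tanh β) {a 0, a 1} * loopO1PartitionFunction G (Real.tanh β) {a 2, a 3} ≤
      (∑ F₁ ∈ tJoins G Set.univ {a 0, a 1}, ∑ F₂ ∈ tJoins G Set.univ {a 2, a 3},
          if (SimpleGraph.fromEdgeSet ((↑F₁ : Set (Sym2 V)) ∪ ↑F₂)).Reachable (a 0) (a 2)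
          then Real.tanh β ^ (F₁.card + F₂.card) else 0) +
      (∑ F₁ ∈ tJoins G Set.univ {a 0, a 2}, ∑ F₂ ∈ tJoins G Set.univ {a 1, a 3},
          if (SimpleGraph.fromEdgeSet ((↑F₁ : Set (Sym2 V)) ∪ ↑F₂)).Reachable (a 0) (a 1)
          then Real.tanh β ^ (F₁.card + F₂.card) else 0) +
      (∑ F₁ ∈ tJoins G Set.univ {a 0, a 3}, ∑ F₂ ∈ tJoins G Set.univ {a 1, a 2},
          if (SimpleGraph.fromEdgeSet ((↑F₁ : Set (Sym2 V)) ∪ ↑F₂)).Reachable (a 0) (a 1)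
          then Real.tanh β ^ (F₁.card + F₂.card) else 0)) :
    connectedFour (isingMeasure G Finset.univ β 0 .free) spinAt a ≤
      -(2 * c / 3 * (twoPoint (isingMeasure G Finset.univ β 0 .free) spinAt (a 0) (a 1) *
        twoPoint (isingMeasure G Finset.univ β 0 .free) spinAt (a 2) (a 3))) := by
  have ht : 0 ≤ Real.tanh β := by
    rw [Real.tanh_eq_sinh_div_cosh]
    exact div_nonneg (Real.sinh_nonneg_iff.2 hβ) (Real.cosh_pos β).le
  have hZ0 : 0 < loopO1PartitionFunction G (Real.tanh β) ∅ := loopO1PartitionFunction_empty_pos G ht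
  have h3 := ShapeSandwich.connectedFour_mul_sq_le_of_jointSum3 G hβ a ha
  have h2 : connectedFour (isingMeasure G Finset.univ β 0 .free) spinAt a *
      (loopO1PartitionFunction G (Real.tanh β) ∅) ^ 2 ≤
      -(2 * c / 3 * (loopO1PartitionFunction G (Real.tanh β) {a 0, a 1} *
        loopO1PartitionFunction G (Real.tanh β) {a 2, a 3})) := by linarith
  rw [twoPoint_eq_loopO1_div hβ (ha.ne (by decide)), twoPoint_eq_loopO1_div hβ (ha.ne (by decide)),
    div_mul_div_comm, ← sq,
    show -(2 * c / 3 * (loopO1PartitionFunction G (Real.tanh β) {a 0, a 1} *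
        loopO1PartitionFunction G (Real.tanh β) {a 2, a 3} / loopO1PartitionFunction G (Real.tanh β) ∅ ^ 2)) =
      -(2 * c / 3 * (loopO1PartitionFunction G (Real.tanh β) {a 0, a 1} *
        loopO1PartitionFunction G (Real.tanh β) {a 2, a 3})) / loopO1PartitionFunction G (Real.tanh β) ∅ ^ 2
      by ring,
    le_div_iff₀ (pow_pos hZ0 2)]
  exact h2

/-- **LSM ⟹ far merging along infinitely many dilations of the same shape** (constant `2c/3`): per box the finite-graph step
`defect_of_jointSum3`, then `criticalDefect_le_of_boxDefect`. [folklore] -/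
theorem shapeMergingIO_of_loopShapeMerging
    (h : ∃ a : Fin 4 → Site 3, Function.Injective a ∧ ∃ c : ℝ, 0 < c ∧ ∀ L₀ : ℕ, ∃ L : ℕ, L₀ ≤ L ∧
      ∃ N₀ : ℕ, ∀ N : ℕ, N₀ ≤ N → ∀ b : Fin 4 → ↥(box 3 N), (∀ i, ((b i : Site 3)) = (L : ℤ) • a i) →
        c * loopO1PartitionFunction ((zdGraph 3).comap (Subtype.val : ↥(box 3 N) → Site 3)) (Real.tanh (criticalBeta 3)) {b 0, b 1} *
            loopO1PartitionFunction ((zdGraph 3).comap (Subtype.val : ↥(box 3 N) → Site 3)) (Real.tanh (criticalBeta 3)) {b 2, b 3} ≤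
          (∑ F₁ ∈ tJoins ((zdGraph 3).comap (Subtype.val : ↥(box 3 N) → Site 3)) Set.univ {b 0, b 1},
              ∑ F₂ ∈ tJoins ((zdGraph 3).comap (Subtype.val : ↥(box 3 N) → Site 3)) Set.univ {b 2, b 3},
                if (SimpleGraph.fromEdgeSet ((↑F₁ : Set (Sym2 ↥(box 3 N))) ∪ ↑F₂)).Reachable (b 0) (b 2)
                then Real.tanh (criticalBeta 3) ^ (F₁.card + F₂.card) else 0) +
          (∑ F₁ ∈ tJoins ((zdGraph 3).comap (Subtype.val : ↥(box 3 N) → Site 3)) Set.univ {b 0, b 2},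
              ∑ F₂ ∈ tJoins ((zdGraph 3).comap (Subtype.val : ↥(box 3 N) → Site 3)) Set.univ {b 1, b 3},
                if (SimpleGraph.fromEdgeSet ((↑F₁ : Set (Sym2 ↥(box 3 N))) ∪ ↑F₂)).Reachable (b 0) (b 1)
                then Real.tanh (criticalBeta 3) ^ (F₁.card + F₂.card) else 0) +
          (∑ F₁ ∈ tJoins ((zdGraph 3).comap (Subtype.val : ↥(box 3 N) → Site 3)) Set.univ {b 0, b 3},
              ∑ F₂ ∈ tJoins ((zdGraph 3).comap (Subtype.val : ↥(box 3 N) → Site 3)) Set.univ {b 1, b 2},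
                if (SimpleGraph.fromEdgeSet ((↑F₁ : Set (Sym2 ↥(box 3 N))) ∪ ↑F₂)).Reachable (b 0) (b 1)
                then Real.tanh (criticalBeta 3) ^ (F₁.card + F₂.card) else 0)) :
    ∃ c : ℝ, 0 < c ∧ ∃ a : Fin 4 → Site 3, Function.Injective a ∧ ∀ L₀ : ℕ, ∃ L : ℕ, L₀ ≤ L ∧
      criticalCorr 3 4 (fun i => (L : ℤ) • a i) -
          (criticalCorr 3 2 ![(L : ℤ) • a 0, (L : ℤ) • a 1] * criticalCorr 3 2 ![(L : ℤ) • a 2, (L : ℤ) • a 3] +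
            criticalCorr 3 2 ![(L : ℤ) • a 0, (L : ℤ) • a 2] * criticalCorr 3 2 ![(L : ℤ) • a 1, (L : ℤ) • a 3] +
            criticalCorr 3 2 ![(L : ℤ) • a 0, (L : ℤ) • a 3] * criticalCorr 3 2 ![(L : ℤ) • a 1, (L : ℤ) • a 2]) ≤
        -(c * (criticalCorr 3 2 ![(L : ℤ) • a 0, (L : ℤ) • a 1] * criticalCorr 3 2 ![(L : ℤ) • a 2, (L : ℤ) • a 3])) := by
  obtain ⟨a, ha, c, hc, hio⟩ := h
  obtain ⟨M, hM⟩ := exists_radius_smul_mem_box a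
  have hβ : 0 ≤ criticalBeta 3 := criticalBeta_nonneg 3
  refine ⟨2 * c / 3, by positivity, a, ha, fun L₀ => ?_⟩
  obtain ⟨L, hL, N₀, hN⟩ := hio (max L₀ 1)
  have hL1 : 1 ≤ L := le_of_max_le_right hL
  refine ⟨L, le_of_max_le_left hL, ?_⟩
  have hl0 : ((L : ℕ) : ℤ) ≠ 0 := by exact_mod_cast (Nat.one_le_iff_ne_zero.1 hL1)
  have hy : Function.Injective (fun i : Fin 4 => (L : ℤ) • a i) := fun i j hij =>
    ha (smul_right_injective (Site 3) hl0 hij)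
  -- the per-box defect inequality for `N ≥ max N₀ (L·M)`
  refine criticalDefect_le_of_boxDefect (y := fun i => (L : ℤ) • a i) (N₀ := max N₀ (L * M))
    (fun N hNN i => hM L N (le_of_max_le_right hNN) i) fun N hNN b hb => ?_
  have hbinj : Function.Injective b := fun i j hij =>
    hy (show (L : ℤ) • a i = (L : ℤ) • a j by rw [← hb i, ← hb j, hij])
  have hJ := hN N (le_of_max_le_left hNN) b hb
  have := defect_of_jointSum3 ((zdGraph 3).comap (Subtype.val : ↥(box 3 N) → Site 3)) hβ b hbinj hJ
  simpa only [Matrix.cons_val_zero, Matrix.cons_val_one] using this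

/-- **LSM ⟹ `NonGaussianLimit`** (item stmt-CriticalPhenomena-0636), unconditionally: far merging along infinitely many dilations of an
injective lattice shape feeds the closed glue `farMergingGivesU4_proof` (item stmt-CriticalPhenomena-4471). [folklore] -/
theorem nonGaussianLimit_of_loopShapeMerging
    (h : ∃ a : Fin 4 → Site 3, Function.Injective a ∧ ∃ c : ℝ, 0 < c ∧ ∀ L₀ : ℕ, ∃ L : ℕ, L₀ ≤ L ∧
      ∃ N₀ : ℕ, ∀ N : ℕ, N₀ ≤ N → ∀ b : Fin 4 → ↥(box 3 N), (∀ i, ((b i : Site 3)) = (L : ℤ) • a i) →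
        c * loopO1PartitionFunction ((zdGraph 3).comap (Subtype.val : ↥(box 3 N) → Site 3)) (Real.tanh (criticalBeta 3)) {b 0, b 1} *
            loopO1PartitionFunction ((zdGraph 3).comap (Subtype.val : ↥(box 3 N) → Site 3)) (Real.tanh (criticalBeta 3)) {b 2, b 3} ≤
          (∑ F₁ ∈ tJoins ((zdGraph 3).comap (Subtype.val : ↥(box 3 N) → Site 3)) Set.univ {b 0, b 1},
              ∑ F₂ ∈ tJoins ((zdGraph 3).comap (Subtype.val : ↥(box 3 N) → Site 3)) Set.univ {b 2, b 3},
                if (SimpleGraph.fromEdgeSet ((↑F₁ : Set (Sym2 ↥(box 3 N))) ∪ ↑F₂)).Reachable (b 0) (b 2)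
                then Real.tanh (criticalBeta 3) ^ (F₁.card + F₂.card) else 0) +
          (∑ F₁ ∈ tJoins ((zdGraph 3).comap (Subtype.val : ↥(box 3 N) → Site 3)) Set.univ {b 0, b 2},
              ∑ F₂ ∈ tJoins ((zdGraph 3).comap (Subtype.val : ↥(box 3 N) → Site 3)) Set.univ {b 1, b 3},
                if (SimpleGraph.fromEdgeSet ((↑F₁ : Set (Sym2 ↥(box 3 N))) ∪ ↑F₂)).Reachable (b 0) (b 1)
                then Real.tanh (criticalBeta 3) ^ (F₁.card + F₂.card) else 0) +
          (∑ F₁ ∈ tJoins ((zdGraph 3).comap (Subtype.val : ↥(box 3 N) → Site 3)) Set.univ {b 0, b 3},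
              ∑ F₂ ∈ tJoins ((zdGraph 3).comap (Subtype.val : ↥(box 3 N) → Site 3)) Set.univ {b 1, b 2},
                if (SimpleGraph.fromEdgeSet ((↑F₁ : Set (Sym2 ↥(box 3 N))) ∪ ↑F₂)).Reachable (b 0) (b 1)
                then Real.tanh (criticalBeta 3) ^ (F₁.card + F₂.card) else 0)) :
    NonGaussianLimit := fun ρ S hρ hlim hnd =>
  farMergingGivesU4_proof (shapeMergingIO_of_loopShapeMerging h) ρ S hρ hlim hnd


end Summit.CriticalPhenomena.Ising3DConformalLimit.Cruxes.IndependentStrandsJoin.PinchToTetra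

/-! ## The registered sub-goal `stub_loopShapeMergingCore` -/

namespace Summit.CriticalPhenomena.Ising3DConformalLimit.Theorems

open Summit.CriticalPhenomena.Ising3DConformalLimit.Cruxes.IndependentStrandsJoin.PinchToTetra

open scoped Classical in
/-- **Registered sub-goal `stub_loopShapeMergingCore` of the crux `IndependentStrandsJoin`** (stmt-CriticalPhenomena-14625, line `pinch-to-tetra` r5):
the loop-language ∃-shape statement LSM implies `NonGaussianLimit` (item stmt-CriticalPhenomena-0636) unconditionally
(`PinchToTetra.nonGaussianLimit_of_loopShapeMerging`). -/
theorem stub_loopShapeMergingCore :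
    (∃ a : Fin 4 → Site 3, Function.Injective a ∧ ∃ c : ℝ, 0 < c ∧ ∀ L₀ : ℕ, ∃ L : ℕ, L₀ ≤ L ∧
      ∃ N₀ : ℕ, ∀ N : ℕ, N₀ ≤ N → ∀ b : Fin 4 → ↥(box 3 N), (∀ i, ((b i : Site 3)) = (L : ℤ) • a i) →
        c * loopO1PartitionFunction ((zdGraph 3).comap (Subtype.val : ↥(box 3 N) → Site 3)) (Real.tanh (criticalBeta 3)) {b 0, b 1} *
            loopO1PartitionFunction ((zdGraph 3).comap (Subtype.val : ↥(box 3 N) → Site 3)) (Real.tanh (criticalBeta 3)) {b 2, b 3} ≤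
          (∑ F₁ ∈ tJoins ((zdGraph 3).comap (Subtype.val : ↥(box 3 N) → Site 3)) Set.univ {b 0, b 1},
              ∑ F₂ ∈ tJoins ((zdGraph 3).comap (Subtype.val : ↥(box 3 N) → Site 3)) Set.univ {b 2, b 3},
                if (SimpleGraph.fromEdgeSet ((↑F₁ : Set (Sym2 ↥(box 3 N))) ∪ ↑F₂)).Reachable (b 0) (b 2)
                then Real.tanh (criticalBeta 3) ^ (F₁.card + F₂.card) else 0) +
          (∑ F₁ ∈ tJoins ((zdGraph 3).comap (Subtype.val : ↥(box 3 N) → Site 3)) Set.univ {b 0, b 2},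
              ∑ F₂ ∈ tJoins ((zdGraph 3).comap (Subtype.val : ↥(box 3 N) → Site 3)) Set.univ {b 1, b 3},
                if (SimpleGraph.fromEdgeSet ((↑F₁ : Set (Sym2 ↥(box 3 N))) ∪ ↑F₂)).Reachable (b 0) (b 1)
                then Real.tanh (criticalBeta 3) ^ (F₁.card + F₂.card) else 0) +
          (∑ F₁ ∈ tJoins ((zdGraph 3).comap (Subtype.val : ↥(box 3 N) → Site 3)) Set.univ {b 0, b 3},
              ∑ F₂ ∈ tJoins ((zdGraph 3).comap (Subtype.val : ↥(box 3 N) → Site 3)) Set.univ {b 1, b 2},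
                if (SimpleGraph.fromEdgeSet ((↑F₁ : Set (Sym2 ↥(box 3 N))) ∪ ↑F₂)).Reachable (b 0) (b 1)
                then Real.tanh (criticalBeta 3) ^ (F₁.card + F₂.card) else 0)) →
      NonGaussianLimit :=
  nonGaussianLimit_of_loopShapeMerging

end Summit.CriticalPhenomena.Ising3DConformalLimit.Theorems

end
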